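import Mathlib

/-!
# Sketch — crux idea `annihilator-recurrence` (crux-ideate round 1, ideator 2)
crux `NewtonUnitEquations.DissociatedUniform` (stmt-ValiantsHypothesis-5905)

Abstract "exchange table" of a rank-`k` tensor at a base word `b` (the `w`-top word of the frame):
letter TYPES `σ` (a change `b_j ↦ α` has type = the ratio vector `(coeff_α f_ij / coeff_{b_j} f_ij)_i`,
zeros allowed), atoms `y i : σ → ℂ` (the `i`-th coordinate of every type) and weights `lam i`
(= `Π_j coeff_{b_j} f_ij`).  The tensor value at the word `b △ s` obtained by a change-multiset
`s : σ →₀ ℕ` (multiplicity `s c` = number of coordinates changed by a letter of type `c`) is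
`table y lam s = Σ_i lam i · y_i^s`.  The first lemmas of the line are identities/inequalities about
this table; none mentions convexity.  STATUS (lean check rc 0): `table_recurrence`, `table_recurrence_family`,
`expsum_vanishing_order`, `multiplicity_lt`, `lcost_add`, `gomory_prod_le` are PROVED (axioms propext /
Classical.choice / Quot.sound); the only `sorry` is the counting shape `card_profiles_le`.  The kinetic
statement the line isolates is `CornerPencilBound`.
-/

set_option linter.dupNamespace false

namespace Summit.ValiantsHypothesis.ValiantsHypothesis.Cruxes.DissociatedUniform.AnnihilatorRecurrence

open scoped BigOperators
open MvPolynomial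

variable {σ : Type*} {k : ℕ}

/-- The exchange table: value of the rank-`k` tensor at the word `b △ s`. -/
noncomputable def table (y : Fin k → σ → ℂ) (lam : Fin k → ℂ) (s : σ →₀ ℕ) : ℂ :=
  ∑ i, lam i * MvPolynomial.eval (y i) (MvPolynomial.monomial s (1 : ℂ))

/-- **First lemma (annihilator recurrence).**  Every polynomial vanishing on the `k` atoms is a linear
recurrence satisfied by the exchange table along every translate:
`Σ_r coeff_r(P) · table (s + r) = Σ_i lam_i y_i^s P(y_i) = 0`.
Proof: `monomial (s+r) 1 = monomial s 1 * monomial r 1`, `eval` is a ring hom, `P = Σ_r monomial r (coeff r P)`. -/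
theorem table_recurrence (y : Fin k → σ → ℂ) (lam : Fin k → ℂ) (P : MvPolynomial σ ℂ)
    (hP : ∀ i, MvPolynomial.eval (y i) P = 0) (s : σ →₀ ℕ) :
    ∑ r ∈ P.support, P.coeff r * table y lam (s + r) = 0 := by
  classical
  have hmul : ∀ i r, eval (y i) (monomial (s + r) (1 : ℂ))
      = eval (y i) (monomial s (1 : ℂ)) * eval (y i) (monomial r (1 : ℂ)) := by
    intro i r
    rw [← map_mul, monomial_mul, one_mul]
  have hP' : ∀ i, eval (y i) P = ∑ r ∈ P.support, P.coeff r * eval (y i) (monomial r (1 : ℂ)) := by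
    intro i
    conv_lhs => rw [P.as_sum]
    rw [map_sum]
    refine Finset.sum_congr rfl fun r _ => ?_
    rw [show monomial r (coeff r P) = C (coeff r P) * monomial r 1 by rw [C_mul_monomial, mul_one],
      map_mul, eval_C]
  have key : ∀ i, ∑ r ∈ P.support, P.coeff r * (lam i * eval (y i) (monomial (s + r) (1 : ℂ)))
      = lam i * eval (y i) (monomial s (1 : ℂ)) * eval (y i) P := by
    intro i
    simp_rw [hmul i]
    rw [hP' i, Finset.mul_sum]
    refine Finset.sum_congr rfl fun r _ => ?_
    ring
  calc ∑ r ∈ P.support, P.coeff r * table y lam (s + r)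
      = ∑ r ∈ P.support, ∑ i, P.coeff r * (lam i * eval (y i) (monomial (s + r) (1 : ℂ))) := by
        refine Finset.sum_congr rfl fun r _ => ?_
        unfold table
        rw [Finset.mul_sum]
    _ = ∑ i, ∑ r ∈ P.support, P.coeff r * (lam i * eval (y i) (monomial (s + r) (1 : ℂ))) :=
        Finset.sum_comm
    _ = ∑ i, lam i * eval (y i) (monomial s (1 : ℂ)) * eval (y i) P :=
        Finset.sum_congr rfl fun i _ => key i
    _ = 0 := by simp [hP]

/-- One-variable core of the multiplicity bound: an exponential sum `e ↦ Σ_i Λ_i z_i^e` that vanishes for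
`e < n` and not at `e = n` needs at least `n+1` distinct bases `z_i`.  (Induction on `n`: twist the weights by
`z_i − z_{i₀}` and drop the indices with `z_i = z_{i₀}`.) -/
theorem expsum_vanishing_order (n : ℕ) : ∀ (ι : Type) [Fintype ι] (Λ z : ι → ℂ),
    (∀ e < n, ∑ i, Λ i * z i ^ e = 0) → (∑ i, Λ i * z i ^ n ≠ 0) →
    n + 1 ≤ (Finset.univ.image z).card := by
  classical
  induction n with
  | zero =>
    intro ι _ Λ z _ halive
    obtain ⟨i₀, -, -⟩ := Finset.exists_ne_zero_of_sum_ne_zero halive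
    exact Finset.card_pos.mpr ⟨z i₀, Finset.mem_image_of_mem z (Finset.mem_univ i₀)⟩
  | succ n ih =>
    intro ι _ Λ z hdead halive
    obtain ⟨i₀, -, -⟩ := Finset.exists_ne_zero_of_sum_ne_zero halive
    -- twisted weights `Λ i * (z i - z i₀)`
    have htw : ∀ e, ∑ i, Λ i * (z i - z i₀) * z i ^ e
        = ∑ i, Λ i * z i ^ (e + 1) - z i₀ * ∑ i, Λ i * z i ^ e := by
      intro e
      rw [Finset.mul_sum, ← Finset.sum_sub_distrib]
      refine Finset.sum_congr rfl fun i _ => ?_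
      ring
    have hdead' : ∀ e < n, ∑ i, Λ i * (z i - z i₀) * z i ^ e = 0 := by
      intro e he
      rw [htw, hdead (e + 1) (by omega), hdead e (by omega)]
      ring
    have halive' : ∑ i, Λ i * (z i - z i₀) * z i ^ n ≠ 0 := by
      rw [htw, hdead n (by omega)]
      simpa using halive
    -- pass to the subtype where `z i ≠ z i₀` (the twisted weights vanish elsewhere)
    have hsub : ∀ e, ∑ j : {i // z i ≠ z i₀}, Λ j * (z j - z i₀) * z j ^ e
        = ∑ i, Λ i * (z i - z i₀) * z i ^ e := by
      intro e
      rw [← Finset.sum_subtype (Finset.univ.filter fun i => z i ≠ z i₀) (by simp)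
        (fun i => Λ i * (z i - z i₀) * z i ^ e)]
      apply Finset.sum_filter_of_ne
      intro i _ hne hz
      apply hne
      simp [hz]
    have h1 : ∀ e < n, ∑ j : {i // z i ≠ z i₀}, Λ j * (z j - z i₀) * z j ^ e = 0 :=
      fun e he => by rw [hsub]; exact hdead' e he
    have h2 : ∑ j : {i // z i ≠ z i₀}, Λ j * (z j - z i₀) * z j ^ n ≠ 0 := by
      rw [hsub]; exact halive'
    have hih := ih {i // z i ≠ z i₀} (fun j => Λ j * (z j - z i₀)) (fun j => z j) h1 h2
    -- the image over the subtype is the full image minus `z i₀`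
    have himg : (Finset.univ.image fun j : {i // z i ≠ z i₀} => z j)
        = (Finset.univ.image z).erase (z i₀) := by
      ext x
      simp only [Finset.mem_image, Finset.mem_univ, true_and, Finset.mem_erase]
      constructor
      · rintro ⟨⟨i, hi⟩, rfl⟩
        exact ⟨hi, i, rfl⟩
      · rintro ⟨hx, i, rfl⟩
        exact ⟨⟨i, hx⟩, rfl⟩
    rw [himg] at hih
    have hmem : z i₀ ∈ Finset.univ.image z := Finset.mem_image_of_mem z (Finset.mem_univ i₀)
    have := Finset.card_erase_add_one hmem
    omega

/-- **Vandermonde multiplicity bound.**  If along one type `c` the table is dead for multiplicities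
`e < n` above `s₀` and alive at `e = n`, then the atoms take at least `n+1` distinct values in coordinate
`c`; in particular `n < k` (one letter type is re-used at most `k-1` times by the top survivor's exchange;
this is the cube lemma of route NewtonUnitEquations in its one-type form, zeros allowed). -/
theorem multiplicity_lt (y : Fin k → σ → ℂ) (lam : Fin k → ℂ) (s₀ : σ →₀ ℕ) (c : σ) (n : ℕ)
    (hdead : ∀ e < n, table y lam (s₀ + Finsupp.single c e) = 0)
    (halive : table y lam (s₀ + Finsupp.single c n) ≠ 0) :
    n + 1 ≤ (Finset.univ.image fun i => y i c).card := by
  classical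
  -- reduce to the one-variable exponential-sum statement `expsum_vanishing_order`
  have hrew : ∀ e, table y lam (s₀ + Finsupp.single c e)
      = ∑ i, (lam i * eval (y i) (monomial s₀ (1 : ℂ))) * (y i c) ^ e := by
    intro e
    unfold table
    refine Finset.sum_congr rfl fun i _ => ?_
    rw [show monomial (s₀ + Finsupp.single c e) (1 : ℂ) = monomial s₀ 1 * X c ^ e by
      rw [X_pow_eq_monomial, monomial_mul, one_mul], map_mul, map_pow, eval_X]
    ring
  simp_rw [hrew] at hdead halive
  exact expsum_vanishing_order n (Fin k) (fun i => lam i * eval (y i) (monomial s₀ (1 : ℂ)))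
    (fun i => y i c) hdead halive

/-- Linear ("clustered") cost of a change-multiset for type prices `γ`. -/
noncomputable def lcost (γ : σ → ℝ) (s : σ →₀ ℕ) : ℝ := s.sum fun c e => (e : ℝ) * γ c

theorem lcost_add (γ : σ → ℝ) (a b : σ →₀ ℕ) : lcost γ (a + b) = lcost γ a + lcost γ b := by
  unfold lcost
  rw [Finsupp.sum_add_index']
  · intro c
    simp
  · intro c e₁ e₂
    push_cast
    ring

/-- Family version of `table_recurrence`: an explicit finite combination of monomials vanishing on the
atoms gives the recurrence with the same coefficients. -/
theorem table_recurrence_family {ι : Type*} (S : Finset ι) (θ : ι → ℂ) (e : ι → σ →₀ ℕ)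
    (y : Fin k → σ → ℂ) (lam : Fin k → ℂ)
    (hP : ∀ i, ∑ r ∈ S, θ r * eval (y i) (monomial (e r) (1 : ℂ)) = 0) (s : σ →₀ ℕ) :
    ∑ r ∈ S, θ r * table y lam (s + e r) = 0 := by
  classical
  have hmul : ∀ i r, eval (y i) (monomial (s + e r) (1 : ℂ))
      = eval (y i) (monomial s (1 : ℂ)) * eval (y i) (monomial (e r) (1 : ℂ)) := by
    intro i r
    rw [← map_mul, monomial_mul, one_mul]
  calc ∑ r ∈ S, θ r * table y lam (s + e r)
      = ∑ r ∈ S, ∑ i, θ r * (lam i * eval (y i) (monomial (s + e r) (1 : ℂ))) := by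
        refine Finset.sum_congr rfl fun r _ => ?_
        unfold table
        rw [Finset.mul_sum]
    _ = ∑ i, ∑ r ∈ S, θ r * (lam i * eval (y i) (monomial (s + e r) (1 : ℂ))) := Finset.sum_comm
    _ = ∑ i, lam i * eval (y i) (monomial s (1 : ℂ)) *
          ∑ r ∈ S, θ r * eval (y i) (monomial (e r) (1 : ℂ)) := by
        refine Finset.sum_congr rfl fun i _ => ?_
        rw [Finset.mul_sum]
        refine Finset.sum_congr rfl fun r _ => ?_
        rw [hmul i r]
        ring
    _ = 0 := by simp [hP]

/-- **Generalised Gomory product bound** (Gomory 1965 for group problems ⇝ rank-`k` tensors), in the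
clustered-cost, unbounded-supply regime: if `n` is a cheapest ALIVE change-multiset for a linear cost that
separates multisets, then `∏_c (n c + 1) ≤ k`.
Proof: if `∏ (n c + 1) > k` the `k`-vectors `(y_i^r)_i`, `r ≤ n`, are dependent, `Σ_r θ_r y_i^r = 0 ∀ i`;
take `r₀ ∈ supp θ` of maximal cost and apply the recurrence with these coefficients at `s = n - r₀`:
every other term sits at a strictly cheaper multiset `n - r₀ + r`, hence is dead, forcing `θ_{r₀}·table n = 0`. -/
theorem gomory_prod_le [DecidableEq σ] (y : Fin k → σ → ℂ) (lam : Fin k → ℂ) (γ : σ → ℝ)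
    (hsep : ∀ s s' : σ →₀ ℕ, lcost γ s = lcost γ s' → s = s')
    (n : σ →₀ ℕ) (halive : table y lam n ≠ 0)
    (hopt : ∀ s : σ →₀ ℕ, lcost γ s < lcost γ n → table y lam s = 0) :
    ∏ c ∈ n.support, (n c + 1) ≤ k := by
  classical
  by_contra hlt
  push Not at hlt
  -- the box of sub-multisets `r ≤ n` has `∏ (n c + 1)` elements
  have hcard : (Finset.Iic n).card = ∏ c ∈ n.support, (n c + 1) := by
    rw [Finsupp.card_Iic]
    refine Finset.prod_congr rfl fun c _ => ?_
    rw [Nat.card_Iic]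
  -- the monomial columns of the box are linearly dependent in `ℂ^k`
  have hdep : ¬ LinearIndependent ℂ
      (fun (r : Finset.Iic n) (i : Fin k) => eval (y i) (monomial (r : σ →₀ ℕ) (1 : ℂ))) := by
    intro hli
    have h := hli.fintype_card_le_finrank
    rw [Module.finrank_fin_fun, Fintype.card_coe, hcard] at h
    omega
  obtain ⟨θ, hθ, r₁, hr₁⟩ := Fintype.not_linearIndependent_iff.mp hdep
  -- a cost-maximal element of the support of `θ`
  obtain ⟨r₀, hr₀S, hr₀max⟩ := Finset.exists_max_image (Finset.univ.filter fun r => θ r ≠ 0)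
    (fun r => lcost γ (r : σ →₀ ℕ)) ⟨r₁, by simpa using hr₁⟩
  have hθr₀ : θ r₀ ≠ 0 := by simpa using hr₀S
  have hr₀le : (r₀ : σ →₀ ℕ) ≤ n := Finset.mem_Iic.mp r₀.2
  -- the recurrence at the translate `n - r₀`
  have hP : ∀ i, ∑ r : Finset.Iic n, θ r * eval (y i) (monomial (r : σ →₀ ℕ) (1 : ℂ)) = 0 := by
    intro i
    have := congr_fun hθ i
    simpa [Finset.sum_apply, Pi.smul_apply, smul_eq_mul] using this
  have hrec := table_recurrence_family Finset.univ θ (fun r : Finset.Iic n => (r : σ →₀ ℕ)) y lam hP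
    (n - r₀)
  -- every term other than `r₀` vanishes: strictly cheaper multiset ⇒ dead
  have hvanish : ∀ r : Finset.Iic n, r ≠ r₀ → θ r * table y lam (n - r₀ + r) = 0 := by
    intro r hr
    by_cases hθr : θ r = 0
    · simp [hθr]
    · have hle : lcost γ (r : σ →₀ ℕ) ≤ lcost γ (r₀ : σ →₀ ℕ) := hr₀max r (by simpa using hθr)
      have hne : lcost γ (r : σ →₀ ℕ) ≠ lcost γ (r₀ : σ →₀ ℕ) := by
        intro h
        exact hr (Subtype.ext (hsep _ _ h))
      have hlt' : lcost γ (r : σ →₀ ℕ) < lcost γ (r₀ : σ →₀ ℕ) := lt_of_le_of_ne hle hne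
      have hcost : lcost γ (n - r₀ + r) < lcost γ n := by
        have h1 : lcost γ (n - ↑r₀) + lcost γ ↑r₀ = lcost γ n := by
          rw [← lcost_add, tsub_add_cancel_of_le hr₀le]
        rw [lcost_add]
        linarith
      rw [hopt _ hcost, mul_zero]
  have hsum : ∑ r : Finset.Iic n, θ r * table y lam (n - r₀ + r) = θ r₀ * table y lam n := by
    rw [Finset.sum_eq_single r₀]
    · rw [tsub_add_cancel_of_le hr₀le]
    · intro r _ hr
      exact hvanish r hr
    · intro h
      exact absurd (Finset.mem_univ r₀) h
  rw [hsum] at hrec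
  exact (mul_ne_zero hθr₀ halive) hrec

/-- Consequence used by the line (shape only): with `T` letter types available and clustered costs, the
cheapest alive exchange ranges over `≤ (T+1)^{⌊log₂ k⌋} · k` profiles (support `≤ log₂ k`, bounded
multiplicities), per cell of the direction circle.  Stated as a plain counting fact about profiles. -/
theorem card_profiles_le (T k : ℕ) :
    ((Finset.univ : Finset (Fin T → Fin (k + 1))).filter
        (fun n => ∏ c, ((n c : ℕ) + 1) ≤ k)).card ≤ (T + 1) ^ (Nat.log 2 k) * (k + 1) ^ (Nat.log 2 k) := by
  sorry

/-- **The pencil lemma isolated by the idea (clustered design core).**  For the cyclic group `ZMod q`,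
residue prices `a c + λ·b c` (`a, b > 0`) and a target `ρ`, the number of change-multisets that are the
unique cheapest representation of `ρ` for SOME `λ ≥ 0` is polynomial in `q`.  These multisets are the
`w`-top survivors of a realisable dissociated `t = 2` character design with `k = q` products and
`m = (q-1)²` coordinates, so the statement is NECESSARY for the crux; the line conjectures that it (with
its capacitated/convex-cost variant) is also the missing half.  Each such multiset is a vertex of Gomory's
master corner polyhedron `P(ZMod q, ρ)`, whose vertex count is `q^{Θ(log q)}` — sparsity alone cannot
give a polynomial bound; the 1-parameter pencil must be used. -/
def CornerPencilBound : Prop :=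
  ∃ C : ℕ, ∀ (q : ℕ) (a b : ZMod q → ℕ) (ρ : ZMod q), 1 < q → (∀ c, 0 < a c) → (∀ c, 0 < b c) →
    Set.ncard {n : ZMod q →₀ ℕ | n 0 = 0 ∧ (n.sum fun c e => e • c) = ρ ∧
        ∃ lam : ℝ, 0 ≤ lam ∧ ∀ n' : ZMod q →₀ ℕ, n' 0 = 0 → (n'.sum fun c e => e • c) = ρ → n' ≠ n →
          (n.sum fun c e => (e : ℝ) * ((a c : ℝ) + lam * b c)) <
            (n'.sum fun c e => (e : ℝ) * ((a c : ℝ) + lam * b c))}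
      ≤ (q + 2) ^ C

end Summit.ValiantsHypothesis.ValiantsHypothesis.Cruxes.DissociatedUniform.AnnihilatorRecurrence
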